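import Summits.MatrixMultiplication.MatrixMultiplication.Theorems.OutsiderSandwichToricCeilingPowThreeCwBaseCensus5B

/-!
# OutsiderSandwich — toric ceiling of `cw₂^{⊠N}`: the `N = 3` three-cw base, PAIR census 5C
(group `cZ5`, part C of 3: 236 of 836 instances; decomp-mm lens 4, gen 47, kernel K47-9 census;
THESES-FREE, `ω`-free; helper toward `LaserTangency`, stmt-32268)

LABEL.  TORIC · FINITE (`N = 3`) · NEC-side instrument.  In CHUNKS of at most 60 instances (kernel
memory / time ceiling on the gate): the certificate pair `datc5[i]` satisfies `goodP₁` for the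
instance `(instOf₁ cZ5)[i]` — both decode to `valid₁` perfect matchings of `cw ⊠ cw ⊠ cw` minus the
instance and the second misses a row of the first (`census₃_5_r`, `decide +kernel`, standard axioms;
no `native_decide`, no `ofReduceBool`); `cover₃_5` collects all chunks of the group.  Consumed by
`…ThreeCwBase`.
WHAT THIS IS NOT: no statement about tensors or `ω`.
-/

set_option linter.dupNamespace false
set_option maxRecDepth 200000
set_option Elab.async false

namespace Summit.MatrixMultiplication.MatrixMultiplication.Theorems.OutsiderSandwichToricCeilingPowThreeCwBaseCensus5C

open Summit.MatrixMultiplication.MatrixMultiplication.Theorems.OutsiderSandwichToricCeilingPowTwoCwBaseDefs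
open Summit.MatrixMultiplication.MatrixMultiplication.Theorems.OutsiderSandwichToricCeilingPowThreeCwBaseDefs
open Summit.MatrixMultiplication.MatrixMultiplication.Theorems.OutsiderSandwichToricCeilingPowThreeCwBaseData5
open Summit.MatrixMultiplication.MatrixMultiplication.Theorems.OutsiderSandwichToricCeilingPowThreeCwBaseCensus5A
open Summit.MatrixMultiplication.MatrixMultiplication.Theorems.OutsiderSandwichToricCeilingPowThreeCwBaseCensus5B

set_option maxHeartbeats 0 in
/-- PAIR CENSUS, group `cZ5`, instances `600 … 659` (kernel-decided). -/
theorem census₃_5_10 : ((((instOf₁ cZ5).zip datc5).drop 600).take 60).all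
    (fun p => goodP₁ p.1 p.2.1 p.2.2) = true := by
  decide +kernel

set_option maxHeartbeats 0 in
/-- PAIR CENSUS, group `cZ5`, instances `660 … 719` (kernel-decided). -/
theorem census₃_5_11 : ((((instOf₁ cZ5).zip datc5).drop 660).take 60).all
    (fun p => goodP₁ p.1 p.2.1 p.2.2) = true := by
  decide +kernel

set_option maxHeartbeats 0 in
/-- PAIR CENSUS, group `cZ5`, instances `720 … 779` (kernel-decided). -/
theorem census₃_5_12 : ((((instOf₁ cZ5).zip datc5).drop 720).take 60).all
    (fun p => goodP₁ p.1 p.2.1 p.2.2) = true := by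
  decide +kernel

set_option maxHeartbeats 0 in
/-- PAIR CENSUS, group `cZ5`, instances `780 … 835` (kernel-decided). -/
theorem census₃_5_13 : ((((instOf₁ cZ5).zip datc5).drop 780).take 56).all
    (fun p => goodP₁ p.1 p.2.1 p.2.2) = true := by
  decide +kernel

/-- Group `cZ5`: every index is covered by a decided chunk (chunks of this file and of the
earlier parts of the group). -/
theorem cover₃_5 : ∀ i < datc5.length, ∃ lo n, lo ≤ i ∧ i < lo + n ∧
    ((((instOf₁ cZ5).zip datc5).drop lo).take n).all (fun p => goodP₁ p.1 p.2.1 p.2.2) = true := by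
  intro i hi
  rw [dlenc5] at hi
  by_cases h0 : i < 60
  · exact ⟨0, 60, by omega, by omega, census₃_5_0⟩
  by_cases h1 : i < 120
  · exact ⟨60, 60, by omega, by omega, census₃_5_1⟩
  by_cases h2 : i < 180
  · exact ⟨120, 60, by omega, by omega, census₃_5_2⟩
  by_cases h3 : i < 240
  · exact ⟨180, 60, by omega, by omega, census₃_5_3⟩
  by_cases h4 : i < 300
  · exact ⟨240, 60, by omega, by omega, census₃_5_4⟩
  by_cases h5 : i < 360
  · exact ⟨300, 60, by omega, by omega, census₃_5_5⟩
  by_cases h6 : i < 420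
  · exact ⟨360, 60, by omega, by omega, census₃_5_6⟩
  by_cases h7 : i < 480
  · exact ⟨420, 60, by omega, by omega, census₃_5_7⟩
  by_cases h8 : i < 540
  · exact ⟨480, 60, by omega, by omega, census₃_5_8⟩
  by_cases h9 : i < 600
  · exact ⟨540, 60, by omega, by omega, census₃_5_9⟩
  by_cases h10 : i < 660
  · exact ⟨600, 60, by omega, by omega, census₃_5_10⟩
  by_cases h11 : i < 720
  · exact ⟨660, 60, by omega, by omega, census₃_5_11⟩
  by_cases h12 : i < 780
  · exact ⟨720, 60, by omega, by omega, census₃_5_12⟩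
  · exact ⟨780, 56, by omega, by omega, census₃_5_13⟩

end Summit.MatrixMultiplication.MatrixMultiplication.Theorems.OutsiderSandwichToricCeilingPowThreeCwBaseCensus5C
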